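import Literature.AnabelianGeometry.EtaleTheta.RealifiedDivisorMonoidsOfRlfWeak
import Literature.AnabelianGeometry.EtaleTheta.Discharge.Sec3RealifiedCuspidal

/-!
# [EtTh] Def. 3.6 (iii)/(v): the non-cuspidal and cuspidal parts of `Φ₀^ℝ(Y)` for the CONSTRUCTED
# Def. 3.6 (i) data over the WEAK vocabulary (`ofRlfZWeak`, `ofRlfRWeak`) — down-closure and disjointness

Mochizuki, *The étale theta function …*, Publ. RIMS **45** (2009), Def. 3.6 (iii) p.77 and Def. 3.1 (i)
p.70 [cite: MochizukiEtTh2009, Def 3.6 p.77]: an element of `Φ^{ℝ-log}(A) = Φ₀^ℝ(A)` is non-cuspidal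
(resp. cuspidal) if it "arises from a non-cuspidal (resp. cuspidal) log-divisor", i.e. (support reading)
is supported in the primes of the special fibre (resp. of the divisor of cusps).

WEAK-VOCABULARY TWIN of `Sec3RealifiedCuspidal.lean` (p413471, same seat) for the constructors
`RealifiedDivisorMonoids.ofRlfZWeak / ofRlfRWeak` (`RealifiedDivisorMonoidsOfRlfWeak.lean`: Def. 3.6 (i)
over abc-iut-L2-t3's `treeMonoidVocabWeak`, hypothesis `IsPerfFactorialCof` instead of the printed
Prop. 3.4 (i), which fails at `Ÿ`, `Z_∞` — cell findings F-L2d2-1 / F-L2d2-2):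
* (R1) the submonoids `rlfSuppInWeak h S` — in particular `(ofRlfZWeak dm hpf).ncspR Y`, `.cspR Y` — are
  DOWN-CLOSED under `∣` and ROOT-CLOSED ((D2b)-type statements);
* (R2) disjoint prime sets give submonoids meeting in `1`; hence `ncspR Y ⊓ cspR Y = ⊥` ((D2a)) as soon
  as the supports of the images of the non-cuspidal and of the cuspidal elements of `Φ₀(Y)` are disjoint
  (`Disjoint (toRSuppOfWeak … ncsp₀) (toRSuppOfWeak … csp₀)`, reduced to the element-wise form by
  `disjoint_toRSuppOfWeak_iff`; the `Φ₀`-level discharge is abc-iut-L2-d2's `DivisorMonoidsCuspidal`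
  chain, whose weak port is separate).
The support lemmas in `M^rlf_factor` (`supp_subset_of_dvd`, `supp_pow_eq`, `eq_one_of_supp_subset_empty`)
are the strong file's, reused (they do not mention perf-factoriality).  Theorems only; no new definitions.
Seat abc-iut-L6-t12 (cell abc-iut; F-L2d2-1 / F-L2d2-2 repair chain, piece (F)).  HONEST FRAMING: nothing
here asserts the data exist for an actual curve; nothing here bears on [IUTchIII] Cor. 3.12.
-/

namespace Literature.AnabelianGeometry.EtaleTheta

open CategoryTheory Opposite Literature.AlgebraicGeometry.Frobenioids

universe u v w

namespace RealifiedDivisorMonoids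

section RlfSuppInWeak

variable {M : Type w} [CommMonoid M]

/-- `rlfSuppInWeak h S` is DOWN-CLOSED under divisibility in `M^rlf` (weak `M`).
[cite: MochizukiEtTh2009, Def 3.6 p.77] -/
theorem rlfSuppInWeak_of_dvd (h : IsPerfFactorialWeak M) (S : Set (Primes (Perfection M)))
    {x y : h.Rlf} (hxy : x ∣ y) (hy : y ∈ rlfSuppInWeak h S) : x ∈ rlfSuppInWeak h S :=
  (supp_subset_of_dvd (map_dvd h.realification.subtype hxy)).trans hy

/-- `rlfSuppInWeak h S` is ROOT-CLOSED in `M^rlf`: `x^n ∈ rlfSuppInWeak h S`, `n ≥ 1` ⇒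
`x ∈ rlfSuppInWeak h S`. [cite: MochizukiEtTh2009, Def 3.6 p.77] -/
theorem rlfSuppInWeak_of_pow_mem (h : IsPerfFactorialWeak M) (S : Set (Primes (Perfection M)))
    {x : h.Rlf} {n : ℕ} (hn : n ≠ 0) (hx : x ^ n ∈ rlfSuppInWeak h S) : x ∈ rlfSuppInWeak h S := by
  change supp ((h.realification.subtype x) ^ n) ⊆ S at hx
  rwa [supp_pow_eq _ hn] at hx

/-- Membership of a power: `x^n ∈ rlfSuppInWeak h S ↔ x ∈ rlfSuppInWeak h S` (`n ≥ 1`).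
[cite: MochizukiEtTh2009, Def 3.6 p.77] -/
theorem pow_mem_rlfSuppInWeak_iff (h : IsPerfFactorialWeak M) (S : Set (Primes (Perfection M)))
    (x : h.Rlf) {n : ℕ} (hn : n ≠ 0) : x ^ n ∈ rlfSuppInWeak h S ↔ x ∈ rlfSuppInWeak h S :=
  ⟨rlfSuppInWeak_of_pow_mem h S hn, fun hx => pow_mem hx n⟩

/-- `rlfSuppInWeak` is monotone in the prime set. [cite: MochizukiEtTh2009, Def 3.6 p.77] -/
theorem rlfSuppInWeak_mono (h : IsPerfFactorialWeak M) {S T : Set (Primes (Perfection M))} (hST : S ⊆ T) :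
    rlfSuppInWeak h S ≤ rlfSuppInWeak h T :=
  fun _ hx => hx.trans hST

/-- If `S ∩ T = ∅` then `rlfSuppInWeak h S ⊓ rlfSuppInWeak h T = ⊥` (an element supported in both has
empty support, hence is `1`). [cite: MochizukiEtTh2009, Def 3.6 p.77] -/
theorem rlfSuppInWeak_inf_eq_bot_of_disjoint (h : IsPerfFactorialWeak M)
    {S T : Set (Primes (Perfection M))} (hST : Disjoint S T) :
    rlfSuppInWeak h S ⊓ rlfSuppInWeak h T = ⊥ := by
  rw [eq_bot_iff]
  rintro x ⟨hxS, hxT⟩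
  rw [Submonoid.mem_bot]
  apply Subtype.ext
  exact eq_one_of_supp_subset_empty fun 𝔮 h𝔮 => (Set.disjoint_left.mp hST (hxS h𝔮) (hxT h𝔮)).elim

end RlfSuppInWeak

/-! ### The (non-)cuspidal parts of `Φ₀^ℝ(Y)` for `ofRlfZWeak` / `ofRlfRWeak` -/

variable {D₀ : Type u} [Category.{v} D₀] (dm : DivisorMonoids.{u, v, w} D₀)
  (hpf : ∀ Y : D₀ᵒᵖ, IsPerfFactorialCof (dm.Φ₀.obj Y))

/-- `ofRlfRWeak` has the same non-cuspidal parts as `ofRlfZWeak`. [cite: MochizukiEtTh2009, Def 3.6 p.77] -/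
theorem ofRlfRWeak_ncspR (Y : D₀ᵒᵖ) : (ofRlfRWeak dm hpf).ncspR Y = (ofRlfZWeak dm hpf).ncspR Y := rfl

/-- `ofRlfRWeak` has the same cuspidal parts as `ofRlfZWeak`. [cite: MochizukiEtTh2009, Def 3.6 p.77] -/
theorem ofRlfRWeak_cspR (Y : D₀ᵒᵖ) : (ofRlfRWeak dm hpf).cspR Y = (ofRlfZWeak dm hpf).cspR Y := rfl

/-- The non-cuspidal part is the support submonoid of the non-cuspidal primes (unfolding).
[cite: MochizukiEtTh2009, Def 3.6 p.77] -/
theorem ofRlfZWeak_ncspR (Y : D₀ᵒᵖ) :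
    (ofRlfZWeak dm hpf).ncspR Y = rlfSuppInWeak (hpf Y).weak (toRSuppOfWeak dm hpf Y (dm.ncsp₀ Y)) := rfl

/-- The cuspidal part is the support submonoid of the cuspidal primes (unfolding).
[cite: MochizukiEtTh2009, Def 3.6 p.77] -/
theorem ofRlfZWeak_cspR (Y : D₀ᵒᵖ) :
    (ofRlfZWeak dm hpf).cspR Y = rlfSuppInWeak (hpf Y).weak (toRSuppOfWeak dm hpf Y (dm.csp₀ Y)) := rfl

/-- **(D2b) The non-cuspidal part of `Φ₀^ℝ(Y)` is down-closed under divisibility** (weak data).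
[cite: MochizukiEtTh2009, Def 3.6 p.77] -/
theorem ofRlfZWeak_ncspR_of_dvd (Y : D₀ᵒᵖ) {x y : (hpf Y).weak.Rlf} (hxy : x ∣ y)
    (hy : y ∈ (ofRlfZWeak dm hpf).ncspR Y) : x ∈ (ofRlfZWeak dm hpf).ncspR Y :=
  rlfSuppInWeak_of_dvd (hpf Y).weak _ hxy hy

/-- **(D2b) The cuspidal part of `Φ₀^ℝ(Y)` is down-closed under divisibility** (weak data).
[cite: MochizukiEtTh2009, Def 3.6 p.77] -/
theorem ofRlfZWeak_cspR_of_dvd (Y : D₀ᵒᵖ) {x y : (hpf Y).weak.Rlf} (hxy : x ∣ y)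
    (hy : y ∈ (ofRlfZWeak dm hpf).cspR Y) : x ∈ (ofRlfZWeak dm hpf).cspR Y :=
  rlfSuppInWeak_of_dvd (hpf Y).weak _ hxy hy

/-- The non-cuspidal part is root-closed: `x^n` non-cuspidal (`n ≥ 1`) iff `x` is (weak data).
[cite: MochizukiEtTh2009, Def 3.6 p.77] -/
theorem ofRlfZWeak_pow_mem_ncspR_iff (Y : D₀ᵒᵖ) (x : (hpf Y).weak.Rlf) {n : ℕ} (hn : n ≠ 0) :
    x ^ n ∈ (ofRlfZWeak dm hpf).ncspR Y ↔ x ∈ (ofRlfZWeak dm hpf).ncspR Y :=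
  pow_mem_rlfSuppInWeak_iff (hpf Y).weak _ x hn

/-- The cuspidal part is root-closed: `x^n` cuspidal (`n ≥ 1`) iff `x` is (weak data).
[cite: MochizukiEtTh2009, Def 3.6 p.77] -/
theorem ofRlfZWeak_pow_mem_cspR_iff (Y : D₀ᵒᵖ) (x : (hpf Y).weak.Rlf) {n : ℕ} (hn : n ≠ 0) :
    x ^ n ∈ (ofRlfZWeak dm hpf).cspR Y ↔ x ∈ (ofRlfZWeak dm hpf).cspR Y :=
  pow_mem_rlfSuppInWeak_iff (hpf Y).weak _ x hn

/-- The disjointness of the non-cuspidal and cuspidal prime sets of `Φ₀(Y)`, element-wise (weak data):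
the images in `Φ₀(Y)^rlf` of a non-cuspidal `a` and a cuspidal `c` have disjoint supports (in print: a
prime log-divisor lies in the special fibre or is a cusp, not both — Def. 3.1 (i) p.70).
[cite: MochizukiEtTh2009, Def 3.1 p.70] -/
theorem disjoint_toRSuppOfWeak_iff (Y : D₀ᵒᵖ) (N C : Submonoid (dm.Φ₀.obj Y)) :
    Disjoint (toRSuppOfWeak dm hpf Y N) (toRSuppOfWeak dm hpf Y C) ↔
      ∀ a ∈ N, ∀ c ∈ C,
        Disjoint
          (supp ((hpf Y).weak.realification.subtype (((toRlfNatTransWeak dm.Φ₀ hpf).app Y).hom a)))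
          (supp ((hpf Y).weak.realification.subtype (((toRlfNatTransWeak dm.Φ₀ hpf).app Y).hom c))) := by
  simp only [toRSuppOfWeak, Set.disjoint_iUnion_left, Set.disjoint_iUnion_right, SetLike.mem_coe]
  exact ⟨fun h a ha c hc => h c hc a ha, fun h c hc a ha => h a ha c hc⟩

/-- The support of the image of `a ∈ Φ₀(Y)` in `Φ₀(Y)^rlf` is the support of the factorization of the
image of `a` in `Φ₀(Y)^pf` (unfolding, for use with `Φ₀`-level support lemmas).
[cite: MochizukiFrdI2008, Def. 2.4 (i) p.48] -/
theorem supp_toR_eq_supp_factorMap (Y : D₀ᵒᵖ) (a : dm.Φ₀.obj Y) :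
    supp ((hpf Y).weak.realification.subtype (((toRlfNatTransWeak dm.Φ₀ hpf).app Y).hom a)) =
      supp (factorMap (dm.Φ₀.obj Y) (Perfection.of _ a)) := rfl

/-- **(D2a) The non-cuspidal and cuspidal parts of `Φ₀^ℝ(Y)` meet in `1`** (weak data), given the
disjointness of the non-cuspidal and cuspidal primes of `Φ₀(Y)`. [cite: MochizukiEtTh2009, Def 3.6 p.77] -/
theorem ofRlfZWeak_ncspR_inf_cspR_eq_bot (Y : D₀ᵒᵖ)
    (hdisj : Disjoint (toRSuppOfWeak dm hpf Y (dm.ncsp₀ Y)) (toRSuppOfWeak dm hpf Y (dm.csp₀ Y))) :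
    (ofRlfZWeak dm hpf).ncspR Y ⊓ (ofRlfZWeak dm hpf).cspR Y = ⊥ :=
  rlfSuppInWeak_inf_eq_bot_of_disjoint (hpf Y).weak hdisj

/-- (D2a), element form (weak data): a simultaneously non-cuspidal and cuspidal element of `Φ₀^ℝ(Y)` is
`1`. [cite: MochizukiEtTh2009, Def 3.6 p.77] -/
theorem ofRlfZWeak_eq_one_of_mem_ncspR_of_mem_cspR (Y : D₀ᵒᵖ)
    (hdisj : Disjoint (toRSuppOfWeak dm hpf Y (dm.ncsp₀ Y)) (toRSuppOfWeak dm hpf Y (dm.csp₀ Y)))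
    {x : (hpf Y).weak.Rlf} (hn : x ∈ (ofRlfZWeak dm hpf).ncspR Y) (hc : x ∈ (ofRlfZWeak dm hpf).cspR Y) :
    x = 1 := by
  have h := ofRlfZWeak_ncspR_inf_cspR_eq_bot dm hpf Y hdisj
  rw [eq_bot_iff] at h
  exact (Submonoid.mem_bot.mp (h ⟨hn, hc⟩))

end RealifiedDivisorMonoids

end Literature.AnabelianGeometry.EtaleTheta
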